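import Summits.RiemannHypothesis.RiemannHypothesis.Theses.DBN
import Summits.RiemannHypothesis.RiemannHypothesis.Theorems.DBNUniformFarZerosReal
import HarnessLib

/-!
# RiemannHypothesis / DBN — the support item `DBN.DbnPerTFinite` (stmt-RiemannHypothesis-0282) closed

LINE 1 — LABEL: **RH-FREE**.  `DBN.DbnPerTFinite` — for every fixed `t > 0` the zeros of
`H_t = Literature.NumberTheory.LFunctions.deBruijnH t` of large enough height are real (Ki–Kim–Lee
2009, Thm. 1.3, reality part) — is VERBATIM the Literature statement
`Literature.NumberTheory.LFunctions.ki_kim_lee_finite`, a THEOREM of the tree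
(`ki_kim_lee_finite_holds`, `XiHeatRayMonotone.lean`: Hermite–Biehler reduction + Laplace's method
on the heat ray).  bears_on: N-C/N-P (LADDER-RH §1, COLUMN 3 DBN; per-`t` base case of the crux
`DbnHighUniform`).  WHAT THIS IS NOT: the threshold depends on `t` and blows up as `t ↓ 0`
(`4π·e^{80/t}` in the explicit form below); a `t`-UNIFORM threshold would be RH-strength
(`DBN.DbnHighUniform`, RH-EQUIVALENT, open) — nothing here bears on the truth of RH.

* `dbnPerTFinite_proof : DBN.DbnPerTFinite` — the item, `:= ki_kim_lee_finite_holds`.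
* `dbnPerTFinite_explicit` — the same with the threshold EXPLICIT: for every `t > 0`, every zero of
  `H_t` with `4π·e^{80/t} ≤ |Re z|` is real (for `t < 1/2` this is K1
  `DbnTheory.im_eq_zero_of_zero_of_exp_le_abs_re` of `Theorems/DBNUniformFarZerosReal.lean`; for
  `t ≥ 1/2` every zero is real, `Λ ≤ 1/2`, de Bruijn 1950), and `dbnPerTFinite_proof'`, the item
  re-derived from it with the witness `T = 4π·e^{80/t}`.

Theorems only; `--workitem stmt-RiemannHypothesis-0282`.

References: H. Ki, Y.-O. Kim, J. Lee, Adv. Math. 222 (2009) 281–306, Thm. 1.3; N. G. de Bruijn,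
Duke Math. J. 17 (1950), Thm. 13.
-/

noncomputable section

-- D-0017: `Summit.<S>.<S>.…` is the designed namespace of a single-problem summit.
set_option linter.dupNamespace false

namespace Summit.RiemannHypothesis.RiemannHypothesis.Theorems

open Literature.NumberTheory.LFunctions
open Summit.RiemannHypothesis.RiemannHypothesis.Theses

/-- **Item stmt-RiemannHypothesis-0282 (`DBN.DbnPerTFinite`)**: for every `t > 0` there is a height
`T` such that every zero `z` of `H_t` with `T ≤ |Re z|` is real — Ki–Kim–Lee 2009 Thm. 1.3 (reality
part), verbatim the tree's theorem `ki_kim_lee_finite_holds`.  RH-FREE. [cite: KiKimLee2009, Thm. 1.3] -/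
theorem dbnPerTFinite_proof : DBN.DbnPerTFinite := by
  unfold DBN.DbnPerTFinite
  exact ki_kim_lee_finite_holds

/-- **Explicit threshold, every `t > 0`**: a zero `z` of `H_t` with `4π·e^{80/t} ≤ |Re z|` is real.
For `0 < t < 1/2` this is K1 (`DbnTheory.im_eq_zero_of_zero_of_exp_le_abs_re`, the explicit form of
the tree's Ki–Kim–Lee proof); for `t ≥ 1/2` all zeros of `H_t` are real (`Λ ≤ 1/2`:
`hasOnlyRealZeros_deBruijnH_one_half_holds` + de Bruijn monotonicity).  RH-FREE; the threshold is
NOT uniform in `t`. [cite: KiKimLee2009, Thm. 1.3] -/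
theorem dbnPerTFinite_explicit {t : ℝ} (ht : 0 < t) {z : ℂ} (hz : deBruijnH t z = 0)
    (hre : 4 * Real.pi * Real.exp (80 / t) ≤ |z.re|) : z.im = 0 := by
  rcases lt_or_ge t (1 / 2) with hlt | hge
  · exact DbnTheory.im_eq_zero_of_zero_of_exp_le_abs_re ht hlt hz hre
  · exact HasOnlyRealZeros.mono_deBruijnH_holds hge hasOnlyRealZeros_deBruijnH_one_half_holds z hz

/-- The item again, from the explicit form, with the witness `T = 4π·e^{80/t}` on display.
RH-FREE. [cite: KiKimLee2009, Thm. 1.3] -/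
theorem dbnPerTFinite_proof' : DBN.DbnPerTFinite := by
  unfold DBN.DbnPerTFinite
  intro t ht
  exact ⟨4 * Real.pi * Real.exp (80 / t), fun z hz hre ↦ dbnPerTFinite_explicit ht hz hre⟩

end Summit.RiemannHypothesis.RiemannHypothesis.Theorems

end
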